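import Mathlib
import Literature.NumberTheory.Irrationality.DirichletLValues.ChowlaMilnorSpaceProofs
import Literature.NumberTheory.Transcendental.LindemannWeierstrassProofs
import HarnessLib

/-!
# The Chowla–Milnor space of modulus `4` (and `3`): Gun–Murty–Rath's Proposition 4, unconditional inputs for Proposition 7

Topic `Literature/NumberTheory/Irrationality/DirichletLValues`. Third proofs-only file on the UNCONDITIONAL half of
S. Gun, M. R. Murty, P. Rath, *On a conjecture of Chowla and Milnor*, Canad. J. Math. **63** (2011) 1328–1344
[GunRammurtyRath2011] (§4 «Concluding Remarks», pp. 1341–1343), after `ChowlaMilnorSpaceProofs.lean` and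
`ChowlaMilnorCoprimeModuliProofs.lean`; Proposition 7 and its Remark are assembled in `ChowlaMilnorOddZetaProofs.lean`.
Read on the page:

* **Proposition 4** (p. 1341): "The Chowla–Milnor conjecture for the single modulus `q = 4` is equivalent to the
  irrationality of `ζ(2d+1)/π^{2d+1}` for all `d ≥ 1`." Proof: "Let `k = 2d + 1`. We note that `V_k(4)` is generated
  by `ζ(k, 1/4)` and `ζ(k, 3/4)` and `(4^k − 2^k)ζ(k) = ζ(k, 1/4) + ζ(k, 3/4)`. Also
  `ζ(k,1/4) − ζ(k,3/4) = (1/(k−1)!) D^{k−1}(π cot πz)|_{z=1/4}`. But `D^{k−1}(π cot πz)|_{z=1/4}` is a rational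
  multiple of `π^k`." The printed proof concerns one ODD `k = 2d + 1` at a time (for even `k` the question at `q = 4`
  is that of `β(2d)/π^{2d}`, on which the source is silent); what is typed is exactly what is proved: for each odd
  `k > 1`, `ζ(k,1/4), ζ(k,3/4)` are `ℚ`-linearly independent iff `ζ(k)/π^k ∉ ℚ` (`linearIndependent_quarter_iff`).
* Proof of Proposition 7 (p. 1343): "`(3^k − 1)ζ(k) = ζ(k,1/3) + ζ(k,2/3)`, `(4^k − 1)ζ(k) = ζ(k,1/4) + ζ(k,3/4) +
  (2^k − 1)ζ(k)`", "When `k − 1` is even, `D^{k−1}(π cot πz)|_{z=1/3}` is a rational multiple of `√3 π^k`, but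
  `D^{k−1}(π cot πz)|_{z=1/4}` is a rational multiple of `π^k`", "Since `π` is transcendental and `√3` is algebraic
  irrational …".

## What is proved (theorems only; no definition is introduced)

With `ζ(k, x) = hurwitzValue k x` (`LinearIndependence.lean`) and `ζ(k) = zetaValue k` (`PeriodsWave0.lean`):
* `hurwitzValue_third_add`, `hurwitzValue_quarter_add` — `ζ(k,1/3) + ζ(k,2/3) = (3^k − 1)ζ(k)`,
  `ζ(k,1/4) + ζ(k,3/4) = (4^k − 2^k)ζ(k)` (the distribution relation `sum_hurwitzValue_div_eq`);
* `exists_rat_hurwitzValue_quarter_sub`, `exists_rat_hurwitzValue_third_sub` — for odd `k ≥ 3`,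
  `ζ(k,1/4) − ζ(k,3/4) = c·π^k` and `ζ(k,1/3) − ζ(k,2/3) = c·√3·π^k` with `c ∈ ℚ` (Mathlib's Bernoulli–Fourier sine
  series `hasSum_one_div_nat_pow_mul_sin` at `x = 1/4, 1/3`, split along residues mod `4`, `3` — the cotangent
  derivatives of the source ARE these sums); both differences are `> 0` (`hurwitzValue_lt_of_lt`), which is all
  that is used of their non-vanishing;
* `pi_pow_ne_add_mul_sqrt_three` — `π^k ∉ ℚ + ℚ√3` (`k ≥ 1`), from the tree's Lindemann theorem `transcendental_pi_holds`;
* **`linearIndependent_quarter_iff`** — PROPOSITION 4 (odd `k`).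

HONEST FRAMING (cells pub-zeta5 / zeta5-irr): kernel theorems of PRINTED statements; the only transcendence INPUT is
the tree's Lindemann theorem, by name; net named-fact debt 0; the Chowla–Milnor conjecture stays OPEN and untyped;
nothing here concerns `ζ(5)`.
-/

noncomputable section

open Finset

open scoped Nat

namespace Literature.NumberTheory.Irrationality.DirichletLValues

open Literature.NumberTheory.Transcendental

/-! ### The sums `ζ(k,1/3) + ζ(k,2/3)`, `ζ(k,1/4) + ζ(k,3/4)` -/

/-- **`ζ(k,1/3) + ζ(k,2/3) = (3^k − 1)ζ(k)`** (`k ≥ 2`). [cite: GunRammurtyRath2011, proof of Proposition 7 (p. 1343)] -/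
theorem hurwitzValue_third_add {k : ℕ} (hk : 2 ≤ k) :
    hurwitzValue k (1 / 3) + hurwitzValue k (2 / 3) = (3 ^ k - 1) * zetaValue k := by
  have h := sum_hurwitzValue_div_eq (m := 3) (k := k) (by norm_num) hk
  rw [show Finset.Ioc 0 3 = {1, 2, 3} by decide, Finset.sum_insert (by decide), Finset.sum_insert (by decide),
    Finset.sum_singleton] at h
  push_cast at h
  rw [show ((3 : ℝ)) / 3 = 1 by norm_num, hurwitzValue_one hk] at h
  linear_combination h

/-- **`ζ(k,1/4) + ζ(k,3/4) = (4^k − 2^k)ζ(k)`** (`k ≥ 2`; the source's "`(4^k − 2^k)ζ(k) = ζ(k,1/4) + ζ(k,3/4)`",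
from the distribution relations at `4` and `2`, `ζ(k,2/4) = ζ(k,1/2) = (2^k − 1)ζ(k)`).
[cite: GunRammurtyRath2011, proof of Proposition 4 (p. 1341)] -/
theorem hurwitzValue_quarter_add {k : ℕ} (hk : 2 ≤ k) :
    hurwitzValue k (1 / 4) + hurwitzValue k (3 / 4) = (4 ^ k - 2 ^ k) * zetaValue k := by
  have h4 := sum_hurwitzValue_div_eq (m := 4) (k := k) (by norm_num) hk
  have h2 := sum_hurwitzValue_div_eq (m := 2) (k := k) (by norm_num) hk
  rw [show Finset.Ioc 0 4 = {1, 2, 3, 4} by decide, Finset.sum_insert (by decide), Finset.sum_insert (by decide),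
    Finset.sum_insert (by decide), Finset.sum_singleton] at h4
  rw [show Finset.Ioc 0 2 = {1, 2} by decide, Finset.sum_insert (by decide), Finset.sum_singleton] at h2
  push_cast at h4 h2
  rw [show ((4 : ℝ)) / 4 = 1 by norm_num, show ((2 : ℝ)) / 4 = 1 / 2 by norm_num, hurwitzValue_one hk] at h4
  rw [show ((2 : ℝ)) / 2 = 1 by norm_num, hurwitzValue_one hk] at h2
  linear_combination h4 - h2

/-! ### The differences `ζ(k,1/4) − ζ(k,3/4) ∈ ℚ·π^k`, `ζ(k,1/3) − ζ(k,2/3) ∈ ℚ·√3·π^k` (odd `k`) -/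

/-- The sine series `Σ_{n ≥ 1} sin(2πn/N)/n^s` split along the residues mod `N`:
`= Σ_{j < N} sin(2πj/N) · Σ_{m ≥ 0} (j + Nm)^{−s}` (`N ≥ 1`, `s ≥ 2`; the term `j = 0` vanishes). [folklore] -/
private theorem tsum_sin_div_pow_eq_sum_residues {s N : ℕ} (hs : 2 ≤ s) (hN : 1 ≤ N) :
    ∑' n : ℕ, 1 / (n : ℝ) ^ s * Real.sin (2 * Real.pi * n * (1 / (N : ℝ))) =
      ∑ j ∈ Finset.range N, Real.sin (2 * Real.pi * j / N) *
        ∑' m : ℕ, 1 / (((j + N * m : ℕ) : ℝ)) ^ s := by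
  obtain ⟨n, rfl⟩ : ∃ n, N = n + 1 := ⟨N - 1, by omega⟩
  have hsum : Summable (fun i : ℕ => 1 / (i : ℝ) ^ s * Real.sin (2 * Real.pi * i * (1 / ((n + 1 : ℕ) : ℝ)))) := by
    have h0 : Summable (fun i : ℕ => 1 / (i : ℝ) ^ s) := Real.summable_one_div_nat_pow.mpr (by omega)
    refine Summable.of_norm_bounded h0 fun i => ?_
    rw [Real.norm_eq_abs, abs_mul]
    calc |1 / (i : ℝ) ^ s| * |Real.sin _| ≤ |1 / (i : ℝ) ^ s| * 1 := by gcongr; exact Real.abs_sin_le_one _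
      _ = 1 / (i : ℝ) ^ s := by rw [mul_one, abs_of_nonneg (by positivity)]
  rw [Nat.sumByResidueClasses hsum (n + 1)]
  have hfin : (∑ j : ZMod (n + 1), ∑' m : ℕ, 1 / (((j.val + (n + 1) * m : ℕ) : ℝ)) ^ s *
        Real.sin (2 * Real.pi * ((j.val + (n + 1) * m : ℕ) : ℝ) * (1 / ((n + 1 : ℕ) : ℝ)))) =
      ∑ j ∈ Finset.range (n + 1), ∑' m : ℕ, 1 / (((j + (n + 1) * m : ℕ) : ℝ)) ^ s *
        Real.sin (2 * Real.pi * ((j + (n + 1) * m : ℕ) : ℝ) * (1 / ((n + 1 : ℕ) : ℝ))) :=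
    Fin.sum_univ_eq_sum_range (fun j => ∑' m : ℕ, 1 / (((j + (n + 1) * m : ℕ) : ℝ)) ^ s *
        Real.sin (2 * Real.pi * ((j + (n + 1) * m : ℕ) : ℝ) * (1 / ((n + 1 : ℕ) : ℝ)))) (n + 1)
  rw [hfin]
  refine Finset.sum_congr rfl fun j _ => ?_
  rw [← tsum_mul_left]
  refine tsum_congr fun m => ?_
  have hper : Real.sin (2 * Real.pi * ((j + (n + 1) * m : ℕ) : ℝ) * (1 / ((n + 1 : ℕ) : ℝ))) =
      Real.sin (2 * Real.pi * j / (n + 1 : ℕ)) := by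
    have hN0 : ((n + 1 : ℕ) : ℝ) ≠ 0 := by positivity
    have hx : ((j + (n + 1) * m : ℕ) : ℝ) * (1 / ((n + 1 : ℕ) : ℝ)) = (j : ℝ) / ((n + 1 : ℕ) : ℝ) + (m : ℝ) := by
      rw [mul_one_div, Nat.cast_add, add_div, Nat.cast_mul, mul_div_cancel_left₀ _ hN0]
    rw [mul_assoc, hx, mul_add, (by ring : 2 * Real.pi * (m : ℝ) = (m : ℕ) * (2 * Real.pi)),
      Real.sin_add_nat_mul_two_pi, ← mul_div_assoc]
  rw [hper, mul_comm]

/-- The Bernoulli polynomial at a rational point, from Mathlib's real form: `(map B_s)(x) = B_s(x)` cast. [folklore] -/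
private theorem bernoulli_map_eval_ratCast (s : ℕ) (x : ℚ) :
    (Polynomial.map (algebraMap ℚ ℝ) (Polynomial.bernoulli s)).eval (x : ℝ) =
      (((Polynomial.bernoulli s).eval x : ℚ) : ℝ) := by
  rw [Polynomial.eval_map, ← eq_ratCast (algebraMap ℚ ℝ), Polynomial.eval₂_at_apply, eq_ratCast]

/-- **`ζ(k,1/4) − ζ(k,3/4) ∈ ℚ·π^k` for odd `k ≥ 3`** — the source's "`D^{k−1}(π cot πz)|_{z=1/4}` is a rational
multiple of `π^k`", here from the Fourier series `Σ_n sin(2πn/4)/n^k = (−1)^{(k+1)/2}(2π)^k B_k(1/4)/(2·k!)`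
(Mathlib `hasSum_one_div_nat_pow_mul_sin`), whose left side is `4^{−k}(ζ(k,1/4) − ζ(k,3/4))`
(`sin(πn/2) = 0, 1, 0, −1` according to `n mod 4`). [cite: GunRammurtyRath2011, proof of Proposition 4 (p. 1341)] -/
theorem exists_rat_hurwitzValue_quarter_sub {k : ℕ} (hk : Odd k) (hk3 : 3 ≤ k) :
    ∃ c : ℚ, hurwitzValue k (1 / 4) - hurwitzValue k (3 / 4) = (c : ℝ) * Real.pi ^ k := by
  obtain ⟨m, rfl⟩ := hk
  have hm : m ≠ 0 := by omega
  have hF := (hasSum_one_div_nat_pow_mul_sin hm (x := 1 / (4 : ℕ))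
    ⟨by positivity, by norm_num⟩).tsum_eq
  rw [tsum_sin_div_pow_eq_sum_residues (by omega) (by norm_num)] at hF
  simp only [Finset.sum_range_succ, Finset.sum_range_zero, zero_add] at hF
  -- the four sines
  have s0 : Real.sin (2 * Real.pi * ((0 : ℕ) : ℝ) / (4 : ℕ)) = 0 := by simp
  have s1 : Real.sin (2 * Real.pi * ((1 : ℕ) : ℝ) / (4 : ℕ)) = 1 := by
    rw [show 2 * Real.pi * ((1 : ℕ) : ℝ) / (4 : ℕ) = Real.pi / 2 by push_cast; ring, Real.sin_pi_div_two]
  have s2 : Real.sin (2 * Real.pi * ((2 : ℕ) : ℝ) / (4 : ℕ)) = 0 := by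
    rw [show 2 * Real.pi * ((2 : ℕ) : ℝ) / (4 : ℕ) = Real.pi by push_cast; ring, Real.sin_pi]
  have s3 : Real.sin (2 * Real.pi * ((3 : ℕ) : ℝ) / (4 : ℕ)) = -1 := by
    rw [show 2 * Real.pi * ((3 : ℕ) : ℝ) / (4 : ℕ) = Real.pi / 2 + Real.pi by push_cast; ring,
      Real.sin_add_pi, Real.sin_pi_div_two]
  rw [s0, s1, s2, s3, zero_mul, zero_mul, one_mul, neg_one_mul, zero_add, add_zero] at hF
  -- the two progressions
  have p1 := (hasSum_progression_hurwitzValue (u := 1) (v := 4) (s := 2 * m + 1) le_rfl (by norm_num)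
    (by omega)).tsum_eq
  have p3 := (hasSum_progression_hurwitzValue (u := 3) (v := 4) (s := 2 * m + 1) (by norm_num) (by norm_num)
    (by omega)).tsum_eq
  have e1 : ∑' n : ℕ, 1 / (((1 + 4 * n : ℕ) : ℝ)) ^ (2 * m + 1) = ∑' n : ℕ, 1 / (((1 + n * 4 : ℕ) : ℝ)) ^ (2 * m + 1) :=
    tsum_congr fun n => by rw [mul_comm]
  have e3 : ∑' n : ℕ, 1 / (((3 + 4 * n : ℕ) : ℝ)) ^ (2 * m + 1) = ∑' n : ℕ, 1 / (((3 + n * 4 : ℕ) : ℝ)) ^ (2 * m + 1) :=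
    tsum_congr fun n => by rw [mul_comm]
  rw [e1, e3, p1, p3, show (1 : ℝ) / (4 : ℕ) = ((1 / 4 : ℚ) : ℝ) by norm_num, bernoulli_map_eval_ratCast,
    ← sub_eq_add_neg, ← mul_sub, one_div_mul_eq_div, div_eq_iff (by positivity)] at hF
  simp only [Nat.cast_one, Nat.cast_ofNat] at hF
  refine ⟨(-1) ^ (m + 1) * 2 ^ (2 * m + 1) / 2 / ((2 * m + 1)! : ℕ) * (Polynomial.bernoulli (2 * m + 1)).eval (1 / 4) *
    4 ^ (2 * m + 1), ?_⟩
  rw [hF]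
  push_cast
  ring

/-- **`ζ(k,1/3) − ζ(k,2/3) ∈ ℚ·√3·π^k` for odd `k ≥ 3`** — the source's "`D^{k−1}(π cot πz)|_{z=1/3}` is a rational
multiple of `√3 π^k`", here from `Σ_n sin(2πn/3)/n^k = (−1)^{(k+1)/2}(2π)^k B_k(1/3)/(2·k!)` with
`sin(2πn/3) = 0, √3/2, −√3/2` according to `n mod 3`. [cite: GunRammurtyRath2011, proof of Proposition 7 (p. 1343)] -/
theorem exists_rat_hurwitzValue_third_sub {k : ℕ} (hk : Odd k) (hk3 : 3 ≤ k) :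
    ∃ c : ℚ, hurwitzValue k (1 / 3) - hurwitzValue k (2 / 3) = (c : ℝ) * Real.sqrt 3 * Real.pi ^ k := by
  obtain ⟨m, rfl⟩ := hk
  have hm : m ≠ 0 := by omega
  have hF := (hasSum_one_div_nat_pow_mul_sin hm (x := 1 / (3 : ℕ))
    ⟨by positivity, by norm_num⟩).tsum_eq
  rw [tsum_sin_div_pow_eq_sum_residues (by omega) (by norm_num)] at hF
  simp only [Finset.sum_range_succ, Finset.sum_range_zero, zero_add] at hF
  -- the three sines
  have s0 : Real.sin (2 * Real.pi * ((0 : ℕ) : ℝ) / (3 : ℕ)) = 0 := by simp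
  have s1 : Real.sin (2 * Real.pi * ((1 : ℕ) : ℝ) / (3 : ℕ)) = Real.sqrt 3 / 2 := by
    rw [show 2 * Real.pi * ((1 : ℕ) : ℝ) / (3 : ℕ) = Real.pi - Real.pi / 3 by push_cast; ring, Real.sin_pi_sub,
      Real.sin_pi_div_three]
  have s2 : Real.sin (2 * Real.pi * ((2 : ℕ) : ℝ) / (3 : ℕ)) = -(Real.sqrt 3 / 2) := by
    rw [show 2 * Real.pi * ((2 : ℕ) : ℝ) / (3 : ℕ) = Real.pi / 3 + Real.pi by push_cast; ring, Real.sin_add_pi,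
      Real.sin_pi_div_three]
  rw [s0, s1, s2, zero_mul, zero_add] at hF
  -- the two progressions
  have p1 := (hasSum_progression_hurwitzValue (u := 1) (v := 3) (s := 2 * m + 1) le_rfl (by norm_num)
    (by omega)).tsum_eq
  have p2 := (hasSum_progression_hurwitzValue (u := 2) (v := 3) (s := 2 * m + 1) (by norm_num) (by norm_num)
    (by omega)).tsum_eq
  have e1 : ∑' n : ℕ, 1 / (((1 + 3 * n : ℕ) : ℝ)) ^ (2 * m + 1) = ∑' n : ℕ, 1 / (((1 + n * 3 : ℕ) : ℝ)) ^ (2 * m + 1) :=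
    tsum_congr fun n => by rw [mul_comm]
  have e2 : ∑' n : ℕ, 1 / (((2 + 3 * n : ℕ) : ℝ)) ^ (2 * m + 1) = ∑' n : ℕ, 1 / (((2 + n * 3 : ℕ) : ℝ)) ^ (2 * m + 1) :=
    tsum_congr fun n => by rw [mul_comm]
  rw [e1, e2, p1, p2, show (1 : ℝ) / (3 : ℕ) = ((1 / 3 : ℚ) : ℝ) by norm_num, bernoulli_map_eval_ratCast]
    at hF
  simp only [Nat.cast_one, Nat.cast_ofNat] at hF
  -- `hF : √3/2·(ζ(k,1/3)/3^k) − √3/2·(ζ(k,2/3)/3^k) = C·B_k(1/3)`; solve for the difference (`(√3)² = 3`)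
  have h3 : Real.sqrt 3 * Real.sqrt 3 = 3 := Real.mul_self_sqrt (by norm_num)
  have h3k : (3 : ℝ) ^ (2 * m + 1) ≠ 0 := by positivity
  set D : ℝ := hurwitzValue (2 * m + 1) (1 / 3) - hurwitzValue (2 * m + 1) (2 / 3) with hD
  set R : ℝ := (-1) ^ (m + 1) * (2 * Real.pi) ^ (2 * m + 1) / 2 / ((2 * m + 1)! : ℕ) *
    (((Polynomial.bernoulli (2 * m + 1)).eval (1 / 3) : ℚ) : ℝ) with hR
  have hF1 : Real.sqrt 3 * D = 2 * 3 ^ (2 * m + 1) * R := by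
    rw [← hF, hD]
    field_simp
    ring
  have hF2 : D = Real.sqrt 3 / 3 * (2 * 3 ^ (2 * m + 1) * R) := by
    rw [← hF1]
    linear_combination (-D / 3) * h3
  refine ⟨(-1) ^ (m + 1) * 2 ^ (2 * m + 1) / 2 / ((2 * m + 1)! : ℕ) * (Polynomial.bernoulli (2 * m + 1)).eval (1 / 3) *
    3 ^ (2 * m + 1) * 2 / 3, ?_⟩
  rw [hF2, hR]
  push_cast
  ring

/-! ### Proposition 4 (odd `k`): `ζ(k,1/4), ζ(k,3/4)` independent iff `ζ(k)/π^k ∉ ℚ` -/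

/-- **Gun–Murty–Rath 2011, Proposition 4, in the form its proof gives** (one odd `k = 2d + 1 > 1` at a time): the
two generators `ζ(k, 1/4), ζ(k, 3/4)` of `V_k(4)` are `ℚ`-linearly independent (i.e. the Chowla–Milnor conjecture holds
for `q = 4` at `k`) iff `ζ(k)/π^k` is irrational. ("`(4^k − 2^k)ζ(k) = ζ(k,1/4) + ζ(k,3/4)`" and "`ζ(k,1/4) − ζ(k,3/4)`
is a rational multiple of `π^k`" — non-zero since `ζ(k,·)` decreases.) The printed sentence "The Chowla–Milnor
conjecture for the single modulus `q = 4` is equivalent to the irrationality of `ζ(2d+1)/π^{2d+1}` for all `d ≥ 1`"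
also quantifies over even `k`, where its proof says nothing; that part is not asserted here.
[cite: GunRammurtyRath2011, Proposition 4 (p. 1341)] -/
theorem linearIndependent_quarter_iff {k : ℕ} (hk : Odd k) (hk1 : 1 < k) :
    LinearIndependent ℚ ![hurwitzValue k (1 / 4), hurwitzValue k (3 / 4)] ↔
      Irrational (zetaValue k / Real.pi ^ k) := by
  have hk3 : 3 ≤ k := by obtain ⟨m, rfl⟩ := hk; omega
  obtain ⟨c, hc⟩ := exists_rat_hurwitzValue_quarter_sub hk hk3
  have hS := hurwitzValue_quarter_add (k := k) (by omega)
  have hDpos : 0 < hurwitzValue k (1 / 4) - hurwitzValue k (3 / 4) :=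
    sub_pos.2 (hurwitzValue_lt_of_lt (by norm_num) (by norm_num) (by omega))
  have hpi : Real.pi ^ k ≠ 0 := pow_ne_zero _ Real.pi_ne_zero
  have hc0 : (c : ℝ) ≠ 0 := by
    rintro h
    rw [h, zero_mul] at hc
    exact hDpos.ne' hc
  have h42 : (4 : ℝ) ^ k - 2 ^ k ≠ 0 := by
    have : (2 : ℝ) ^ k < 4 ^ k := pow_lt_pow_left₀ (by norm_num) (by norm_num) (by omega)
    linarith
  rw [LinearIndependent.pair_iff]
  constructor
  · -- a rational value of `ζ(k)/π^k` produces a non-trivial relation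
    intro hli
    rw [irrational_iff_ne_rational]
    intro a b hb0 hab
    have hb : (b : ℝ) ≠ 0 := by exact_mod_cast hb0
    rw [div_eq_div_iff hpi hb] at hab
    -- `b·ζ(k) = a·π^k`, so `bc·(ζ₁ + ζ₃) − (4^k − 2^k)a·(ζ₁ − ζ₃) = 0`
    have hrel : (c * b - (4 ^ k - 2 ^ k) * a : ℚ) • hurwitzValue k (1 / 4) +
        (c * b + (4 ^ k - 2 ^ k) * a : ℚ) • hurwitzValue k (3 / 4) = 0 := by
      rw [Rat.smul_def, Rat.smul_def]
      push_cast
      linear_combination (↑c * (b : ℝ)) * hS - (((4 : ℝ) ^ k - 2 ^ k) * (a : ℝ)) * hc +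
        (↑c * ((4 : ℝ) ^ k - 2 ^ k)) * hab
    obtain ⟨h1, h2⟩ := hli _ _ hrel
    have hcb : c * b = 0 := by linear_combination (h1 + h2) / 2
    rcases mul_eq_zero.1 hcb with h | h
    · exact hc0 (by exact_mod_cast h)
    · exact hb0 (by exact_mod_cast h)
  · -- conversely, a relation with `s + t ≠ 0` makes `ζ(k)/π^k` rational, and `s + t = 0` forces `s = t = 0`
    intro hirr s t hst
    rw [Rat.smul_def, Rat.smul_def] at hst
    -- `2ζ₁ = S + D`, `2ζ₃ = S − D`
    have key : ((s : ℝ) + t) * ((4 ^ k - 2 ^ k) * zetaValue k) + ((s : ℝ) - t) * (c * Real.pi ^ k) = 0 := by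
      rw [← hS, ← hc]
      linear_combination 2 * hst
    by_cases hsum : s + t = 0
    · have hsum' : (s : ℝ) + t = 0 := by exact_mod_cast hsum
      rw [hsum', zero_mul, zero_add, mul_eq_zero] at key
      rcases key with h | h
      · have hdiff : s - t = 0 := by exact_mod_cast h
        exact ⟨by linear_combination hdiff / 2 + hsum / 2, by linear_combination hsum / 2 - hdiff / 2⟩
      · exact absurd h (mul_ne_zero hc0 hpi)
    · exfalso
      refine hirr ⟨-((s - t) * c / ((s + t) * (4 ^ k - 2 ^ k))), ?_⟩
      have hst' : (s : ℝ) + t ≠ 0 := by exact_mod_cast hsum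
      push_cast
      rw [← neg_div, div_eq_div_iff (mul_ne_zero hst' h42) hpi]
      linear_combination -key

/-! ### Proposition 7: `ζ(k) ∉ ℚ` iff `dim V̂_k(3) = 3` or `dim V̂_k(4) = 3` (odd `k`) -/

/-- **`π^k ∉ ℚ + ℚ√3`** (`k ≥ 1`): if `π^k = e + f√3` then `π` is a root of `(X^k − e)² − 3f² ∈ ℚ[X] ∖ {0}`,
contradicting Lindemann's theorem (tree: `transcendental_pi_holds`). This is the use of "`π` is transcendental and
`√3` is algebraic irrational" in the proof of Proposition 7. [cite: GunRammurtyRath2011, proof of Proposition 7 (p. 1343)] -/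
theorem pi_pow_ne_add_mul_sqrt_three {k : ℕ} (hk : 1 ≤ k) (e f : ℚ) :
    Real.pi ^ k ≠ (e : ℝ) + f * Real.sqrt 3 := by
  intro h
  have h3 : Real.sqrt 3 * Real.sqrt 3 = 3 := Real.mul_self_sqrt (by norm_num)
  have hsq : (Real.pi ^ k - e) ^ 2 - 3 * (f : ℝ) ^ 2 = 0 := by
    rw [h]
    linear_combination (f : ℝ) ^ 2 * h3
  apply transcendental_pi_holds
  have hm : ((Polynomial.X ^ k - Polynomial.C e) ^ 2 : Polynomial ℚ).Monic :=
    (Polynomial.monic_X_pow_sub_C e (by omega)).pow 2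
  have hdeg : ((Polynomial.X ^ k - Polynomial.C e) ^ 2 : Polynomial ℚ).natDegree = 2 * k := by
    rw [(Polynomial.monic_X_pow_sub_C e (by omega)).natDegree_pow 2, Polynomial.natDegree_X_pow_sub_C]
  refine ⟨(Polynomial.X ^ k - Polynomial.C e) ^ 2 - Polynomial.C (3 * f ^ 2), ?_, ?_⟩
  · refine Polynomial.Monic.ne_zero (hm.sub_of_left (Polynomial.degree_C_le.trans_lt ?_))
    rw [Polynomial.degree_eq_natDegree hm.ne_zero, hdeg]
    exact_mod_cast (show 0 < 2 * k by omega)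
  · simp only [map_sub, map_pow, map_mul, Polynomial.aeval_X, Polynomial.aeval_C, eq_ratCast]
    push_cast
    linear_combination hsq

end Literature.NumberTheory.Irrationality.DirichletLValues

end
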